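import Summits.QuantumFields.BalabanUV.Beta.D1BFx.RoadEndBFxRecutS
import Summits.QuantumFields.BalabanUV.Beta.D1BFx.RoadEndBFxRecutShell

/-!
# `BalabanUV.Beta.D1BFx.RoadEndBFxRecutShellS` — road «BF-x» for binder row D1: THE PER-WORD END IN SHELL CURRENCY (+ its ray twin), variant «ENDₛ»
# (END-ii-SPEC v1.2 §6 backlog): `RoadEndBFxRecutShell` with `(hω) ↦ (s)(hωs)` and the words `restKS (gfrz n a b) (s n • gfrz n a b)`

HONEST DEPENDENCY (page 1, mandatory): continuum YM on T⁴ ⇐ BetaPertH ∧ nine spine estimates (0/9 proved); BetaPertH ⇐ (D1) ∧ (D4) ∧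
CAP+tail; G-an2-4 gates asym, D1 and NE2/3/4.  HONEST FRAMING (cell contract, verbatim): «discharging `BetaPertH` makes Bałaban's UV
stability UNCONDITIONAL — a real constructive-QFT result; it is NOT the continuum limit and NOT the Clay problem.»  THIS MODULE DISCHARGES
NOTHING of the wall: [folklore] composition BY NAME of `ShellRoadEnd.d1Drift_of_strongRoad_shell` with `AssemblyEndRecutS.defect_le_at_recutS`, `RoadEndBFxRecutS.rest_all_of_offCornerS`,
the near rows of `gfrz`; the record's `h2s_of_h2`∕`d2s_of_d2` are reused by name.  No `def`, nothing cited, 0 sorry.  0 wall binders (hW ∕ hR-sockets ∕ hSX-socket ∕ D1Tel ∕ D1Rep = 0);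
NOT (K), NOT D1, NOT `BetaPertH`, NOT continuum, NOT Clay.

ABSOLUTE RULE (cell charter, verbatim): «No internally-minted statement may enter as a cited fact. Every hypothesis is either kernel-proved in
this package or a verbatim quotation of a PUBLISHED theorem with page reference. The manuscript(s) under audit are NOT citable for their own
disputed steps — they are the thing under adjudication; programme-internal (2001/route/tribunal) claims are never citable.»

CONTENT.
* §2 [folklore] **`d1Drift_BFx_recut_shellS`**.  §3 **`d1Drift_BFx_recut_ray_shellS`**.
Unit `b2b-balaban-beta-d1-p2` (road owner, gen 12); `LEAVES-BFx.md` row A7-ENDₛ (per-word ∕ total lanes); END-ii-SPEC v1.2 §6 backlog.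
-/

noncomputable section

open Finset Filter Topology
open scoped BigOperators
open Literature.Probability.LatticeModels (annulus)
open Literature.MathematicalPhysics.QuantumFieldTheory.Balaban1983to89
open Literature.MathematicalPhysics.QuantumFieldTheory.Balaban1983to89.Beta
open OneStepResolventKernel (JetData)
open OneStepKernelFamily (TbalOf D1Drift)
open WindowIdentification (fullSum psum)
open DyadicShell (Pt toReal supNorm supNorm_eq_of_mem_sphere ne_zero_of_mem_annulus)
open ExpKernelCalculus (Site MKer BiLoc shiftK)
open SquareTable (stK)
open GhostTable (gFree)
open BubbleTransfer (unitVec)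
open DressedMomentNormalisation (resSite)
open Summit.QuantumFields.BalabanUV.Beta.TameKernelCalculus (Spr)
open Summit.QuantumFields.BalabanUV.Beta.D1BFx.GluonLeg (Ga)
open Summit.QuantumFields.BalabanUV.Beta.D1BFx.ReducedKernel (TableR TOfRed)
open Summit.QuantumFields.BalabanUV.Beta.D1BFx.DressedTadpoleTable (tableRed)
open Summit.QuantumFields.BalabanUV.Beta.D1BFx.ReducedKernelSandwich (fineHess)
open Summit.QuantumFields.BalabanUV.Beta.D1BFx.FineStencilBFBalaban (SbfBal)
open Summit.QuantumFields.BalabanUV.Beta.D1BFx.SecondStencilBF (Wbf)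
open Summit.QuantumFields.BalabanUV.Beta.D1BFx.GhostKernelComplete (PghQ fineHessGhQ hasSum_row_fineHessGhQ_ray)
open Summit.QuantumFields.BalabanUV.Beta.D1BFx.FrozenLegProfile (gfrz gfrz_neg decay_gfrz abs_gfrz_sub_gFree_le abs_gfrz_diff_flat_le)
open Summit.QuantumFields.BalabanUV.Beta.D1BFx.SplitInstance (RestIdx)
open Summit.QuantumFields.BalabanUV.Beta.D1BFx.SplitInstanceS (restKS)
open Summit.QuantumFields.BalabanUV.Beta.D1BFx.Assembly (sum_uniform_resSite)
open Summit.QuantumFields.BalabanUV.Beta.D1BFx.AssemblyEnd (hT_of_pointwise)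
open Summit.QuantumFields.BalabanUV.Beta.D1BFx.RoadEndBFxRecut (cornerIdx rowConst gfrz₀ gfrz₀_eq rowConst_nonneg)
open Summit.QuantumFields.BalabanUV.Beta.D1BFx.RoadEndBFxRecutS (rest_all_of_offCornerS)
open Summit.QuantumFields.BalabanUV.Beta.D1BFx.AssemblyEndRecutS (defect_le_at_recutS)
open Summit.QuantumFields.BalabanUV.Beta.D1BFx.ShellStencils (shell_sum_le_of_pointwise)
open Summit.QuantumFields.BalabanUV.Beta.D1BFx.ShellRoadEnd (d1Drift_of_strongRoad_shell)

namespace Summit.QuantumFields.BalabanUV.Beta.D1BFx.RoadEndBFxRecutShellS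

/-! ## §2 The road END over the re-cut table at the frozen profile of record, far rows in shell currency -/

variable {Lc : ℕ} [NeZero Lc] {a N : ℝ} {μ ν : Fin 4} {υ : Type*} [Fintype υ]
  {cE cVH cΛ cR cK cQ cgh cE₂ cJ4 cΛ₂ cR₂ cQ₂ x₀ ωgl ωgh : ℕ → ℝ} {WE WJ WΛ WR WQ : ℕ → TableR} {CE CJ CΛ CRt CQ δW : ℕ → ℝ}
  {Ru : υ → ℕ → ℝ} {CU : υ → ℝ} {CR : RestIdx → ℝ} {A : ℕ → ℝ} {D₂ δ U₁ : ℝ}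

/-- [folklore] **«ENDₛ» VARIANT** (rescaled tie `hωs` with a displayed family `s`; (REST′) words `restKS (gfrz n a b) (s n • gfrz n a b)`; `s ≡ 1` = the record) of the record's theorem of the same name without the `S`: **ROAD BF-x, END TO END, OVER THE RE-CUT REST TABLE AT THE FROZEN PROFILE `gfrz`, FAR ROWS IN SHELL-ℓ¹ CURRENCY** (strong grading,
odd blocking factor).  Exactly `RoadEndBFxRecut.d1Drift_BFx_recut` (B1 `hB1`; (K) `hK` + `hω` + `hlam`; the (α)-leaf `Spr (Ga n a)`; the slot-table
sockets; `hdiv`; `hrowgh`; (REST′) off the corner; (U) — VERBATIM) except that the far rows h2∕d2 of `gfrz` are the SHELL rows `h2s`∕`d2s` of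
leaf-07-g4's `ShellRoadEnd.d1Drift_of_strongRoad_shell` (window cut-off `M n = n`); the pointwise rows d0∕d1 stay as they are (they are (1.110) content). -/
theorem d1Drift_BFx_recut_shellS (Js : ℕ → JetData 3 Lc) (hμν : μ ≠ ν) (hN : N ≠ 0) (hL : 2 ≤ Lc) (hodd : Odd Lc) (ha : 0 < a) (c : ℕ → ℝ)
    (hD₂ : 0 ≤ D₂) (hA : ∀ j, 0 ≤ A j) (hδ : 0 < δ)
    -- the frozen profile's FAR rows: h2s∕d2s in SHELL currency, d0∕d1 pointwise
    (h2s : ∀ n : ℕ, 2 ≤ n → ∀ [NeZero n], ∀ b ∈ (univ : Finset (Fin 4 → Fin n)).image resSite, ∀ r : ℕ, r + 1 ≤ n →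
      ∑ v ∈ annulus 4 r (r + 1), |(gfrz n a b (v + unitVec ν + unitVec μ) - gFree (v + unitVec ν + unitVec μ)) -
          (gfrz n a b (v + unitVec ν) - gFree (v + unitVec ν)) - (gfrz n a b (v + unitVec μ) - gFree (v + unitVec μ)) +
          (gfrz n a b v - gFree v)| ≤ D₂ / (n : ℝ))
    (d0 : ∀ n : ℕ, 2 ≤ n → ∀ [NeZero n], ∀ b ∈ (univ : Finset (Fin 4 → Fin n)).image resSite, ∀ v : Pt, v ≠ 0 →
      |gfrz n a b v| ≤ A 0 * Real.exp (-(δ / n) * supNorm v) / (supNorm v : ℝ) ^ 2)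
    (d1 : ∀ n : ℕ, 2 ≤ n → ∀ [NeZero n], ∀ b ∈ (univ : Finset (Fin 4 → Fin n)).image resSite, ∀ v : Pt, v ≠ 0 → ∀ ρ : Fin 4,
      |gfrz n a b (v + unitVec ρ) - gfrz n a b v| ≤ A 1 * Real.exp (-(δ / n) * supNorm v) / (supNorm v : ℝ) ^ 3)
    (d2s : ∀ n : ℕ, 2 ≤ n → ∀ [NeZero n], ∀ b ∈ (univ : Finset (Fin 4 → Fin n)).image resSite, ∀ r : ℕ, n ≤ r →
      ∑ v ∈ annulus 4 r (r + 1), |gfrz n a b (v + unitVec ν + unitVec μ) - gfrz n a b (v + unitVec ν) - gfrz n a b (v + unitVec μ) + gfrz n a b v| ≤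
        A 2 * Real.exp (-(δ / n) * ((r : ℝ) + 1)) / ((r : ℝ) + 1))
    -- bridge B1
    (hB1 : ∀ m : ℕ, 1 ≤ m → |(∑ j ∈ range m, B12Beta.secondMoment (TbalOf Lc Js j) μ ν) - c (Lc ^ m)| ≤ U₁)
    -- the (α)-leaf and slot (K) with the loop-weight ratio and the PINNED normalisation
    (hGa : ∀ n : ℕ, 2 ≤ n → ∀ [NeZero n], Spr (Ga n a))
    (hK : ∀ n : ℕ, 2 ≤ n → Odd n → ∀ [NeZero n], c n =
      ωgl n * B12Beta.secondMoment (TOfRed n a (SbfBal n a (cE n) (cVH n) (cΛ n) (cR n) (cK n) (cQ n))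
        (tableRed n (Wbf (cE₂ n) (cJ4 n) (cΛ₂ n) (cR₂ n) (cQ₂ n) (WE n) (WJ n) (WΛ n) (WR n) (WQ n)))) μ ν
      + ωgh n * B12Beta.secondMoment (PghQ n a (x₀ n) (cK n) (cQ n)) μ ν + ∑ u, Ru u n)
    (s : ℕ → ℝ) (hωs : ∀ n : ℕ, 2 ≤ n → ωgh n * (s n * cK n) ^ 2 = -2 * (ωgl n * cE n ^ 2))
    (hlam : ∀ n : ℕ, 2 ≤ n → ωgl n * cE n ^ 2 = 2 * N ^ 2 * (n : ℝ) ^ 8)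
    -- slot-table sockets
    (hδW : ∀ n, 0 < δW n)
    (hE : ∀ n κ u l u', BiLoc (WE n κ u l u') u u' (CE n) (δW n)) (hJ : ∀ n κ u l u', BiLoc (WJ n κ u l u') u u' (CJ n) (δW n))
    (hΛ : ∀ n κ u l u', BiLoc (WΛ n κ u l u') u u' (CΛ n) (δW n)) (hR : ∀ n κ u l u', BiLoc (WR n κ u l u') u u' (CRt n) (δW n))
    (hQ : ∀ n κ u l u', BiLoc (WQ n κ u l u') u u' (CQ n) (δW n))
    (hEc : ∀ (n : ℕ) (κ : Fin 4) (u : Site 4) (l : Fin 4) (u' t : Site 4),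
      WE n κ (u + (n : ℤ) • t) l (u' + (n : ℤ) • t) = shiftK (-((n : ℤ) • t)) (WE n κ u l u'))
    (hJc : ∀ (n : ℕ) (κ : Fin 4) (u : Site 4) (l : Fin 4) (u' t : Site 4),
      WJ n κ (u + (n : ℤ) • t) l (u' + (n : ℤ) • t) = shiftK (-((n : ℤ) • t)) (WJ n κ u l u'))
    (hΛc : ∀ (n : ℕ) (κ : Fin 4) (u : Site 4) (l : Fin 4) (u' t : Site 4),
      WΛ n κ (u + (n : ℤ) • t) l (u' + (n : ℤ) • t) = shiftK (-((n : ℤ) • t)) (WΛ n κ u l u'))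
    (hRc : ∀ (n : ℕ) (κ : Fin 4) (u : Site 4) (l : Fin 4) (u' t : Site 4),
      WR n κ (u + (n : ℤ) • t) l (u' + (n : ℤ) • t) = shiftK (-((n : ℤ) • t)) (WR n κ u l u'))
    (hQc : ∀ (n : ℕ) (κ : Fin 4) (u : Site 4) (l : Fin 4) (u' t : Site 4),
      WQ n κ (u + (n : ℤ) • t) l (u' + (n : ℤ) • t) = shiftK (-((n : ℤ) • t)) (WQ n κ u l u'))
    (hEs : ∀ n κ u l u', WE n κ u l u' = WE n l u' κ u) (hJs : ∀ n κ u l u', WJ n κ u l u' = WJ n l u' κ u)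
    (hΛs : ∀ n κ u l u', WΛ n κ u l u' = WΛ n l u' κ u) (hRs : ∀ n κ u l u', WR n κ u l u' = WR n l u' κ u)
    (hQs : ∀ n κ u l u', WQ n κ u l u' = WQ n l u' κ u)
    -- first-bond divergence-freeness of the gluon fine Hessian kernel; the ghost Ward rows
    (hdiv : ∀ n : ℕ, 2 ≤ n → ∀ [NeZero n], ∀ (l' : Fin 4) (u' u : Site 4), ∑ κ' : Fin 4,
      (fineHess n a (SbfBal n a (cE n) (cVH n) (cΛ n) (cR n) (cK n) (cQ n))
          (Wbf (cE₂ n) (cJ4 n) (cΛ₂ n) (cR₂ n) (cQ₂ n) (WE n) (WJ n) (WΛ n) (WR n) (WQ n)) κ' l' (u - Pi.single κ' 1) u'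
        - fineHess n a (SbfBal n a (cE n) (cVH n) (cΛ n) (cR n) (cK n) (cQ n))
          (Wbf (cE₂ n) (cJ4 n) (cΛ₂ n) (cR₂ n) (cQ₂ n) (WE n) (WJ n) (WΛ n) (WR n) (WQ n)) κ' l' u u') = 0)
    (hrowgh : ∀ n : ℕ, 2 ≤ n → ∀ [NeZero n], ∀ (κ' l' : Fin 4) (b : Site 4), HasSum (fineHessGhQ n a (x₀ n) (cK n) (cQ n) κ' l' b) 0)
    -- (REST′) for the re-cut words other than the corner, n-UNIFORM; (U)
    (hRest : ∀ n : ℕ, 2 ≤ n → ∀ [NeZero n], ∀ τ : RestIdx, τ ≠ cornerIdx →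
      |∑ b ∈ (univ : Finset (Fin 4 → Fin n)).image resSite, ((n : ℝ) ^ 4)⁻¹ *
        fullSum (fun w : Pt => restKS n a (gfrz n a b) (fun v => s n * gfrz n a b v) (cE n) (cΛ n) (cR n) (cK n) (cQ n) (cE₂ n) (cJ4 n) (cΛ₂ n) (cR₂ n) (cQ₂ n) (x₀ n)
          (WE n) (WJ n) (WΛ n) (WR n) (WQ n) (ωgl n) (ωgh n) ((n : ℝ) ^ 8) N μ ν b τ w)| ≤ CR τ)
    (hU : ∀ n : ℕ, 2 ≤ n → ∀ u, |Ru u n| ≤ CU u) :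
    D1Drift Lc Js N μ ν := by
  refine d1Drift_of_strongRoad_shell Js hμν hN hL c (Bset := fun n => (univ : Finset (Fin 4 → Fin n)).image resSite)
    (wt := fun n _ => ((n : ℝ) ^ 4)⁻¹) (Gf := gfrz₀ a) (U₂ := (∑ u, CU u) + ∑ τ : RestIdx, (if τ = cornerIdx then 0 else CR τ))
    (D := rowConst a D₂) (A := A) (δ := δ)
    (rowConst_nonneg ha hD₂) hA hδ (fun n _ _ _ => by positivity) (fun n hn => sum_uniform_resSite (by omega)) ?_ ?_ ?_ ?_ ?_ ?_ hB1 ?_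
  · -- h0, UNCONDITIONAL
    intro n hn b _ v
    haveI : NeZero n := ⟨by omega⟩
    rw [gfrz₀_eq a n]
    exact abs_gfrz_sub_gFree_le n (le_trans one_le_two hn) ha b v
  · -- h1, UNCONDITIONAL
    intro n hn b _ v ρ
    haveI : NeZero n := ⟨by omega⟩
    rw [gfrz₀_eq a n]
    exact abs_gfrz_diff_flat_le n (le_trans one_le_two hn) ha b v ρ
  · -- h2s, SHELL currency
    intro n hn b hb r hr
    haveI : NeZero n := ⟨by omega⟩
    rw [gfrz₀_eq a n]
    exact h2s n hn b hb r hr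
  · intro n hn b hb v hv
    haveI : NeZero n := ⟨by omega⟩
    rw [gfrz₀_eq a n]
    exact d0 n hn b hb v hv
  · intro n hn b hb v hv ρ
    haveI : NeZero n := ⟨by omega⟩
    rw [gfrz₀_eq a n]
    exact d1 n hn b hb v hv ρ
  · -- d2s, SHELL currency
    intro n hn b hb r hr
    haveI : NeZero n := ⟨by omega⟩
    rw [gfrz₀_eq a n]
    exact d2s n hn b hb r hr
  -- the road's target `hT` along `n = Lc^m` (verbatim from the END of record)
  refine hT_of_pointwise (c := c)
    (F := fun n => ∑ b ∈ (univ : Finset (Fin 4 → Fin n)).image resSite, ((n : ℝ) ^ 4)⁻¹ * fullSum (stK μ ν N (gfrz₀ a n b)))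
    (U := (∑ u, CU u) + ∑ τ : RestIdx, (if τ = cornerIdx then 0 else CR τ)) (fun n hn hon => ?_) hL hodd
  haveI : NeZero n := ⟨by omega⟩
  rw [gfrz₀_eq a n]
  exact defect_le_at_recutS n a (cE n) (cVH n) (cΛ n) (cR n) (cK n) (cQ n) (cE₂ n) (cJ4 n) (cΛ₂ n) (cR₂ n) (cQ₂ n) (x₀ n) (ωgl n) (ωgh n)
    ((n : ℝ) ^ 8) N (gp := gfrz n a) hn hon ha hμν (hGa n hn) (hK n hn hon) (s n) (hωs n hn) (hlam n hn) (hδW n) (hE n) (hJ n) (hΛ n) (hR n)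
    (hQ n) (hEc n) (hJc n) (hΛc n) (hRc n) (hQc n) (hEs n) (hJs n) (hΛs n) (hRs n) (hQs n) (hdiv n hn) (hrowgh n hn)
    (fun b => decay_gfrz (hGa n hn) b) (fun b w => gfrz_neg w)
    (rest_all_of_offCornerS n a (cE n) (cΛ n) (cR n) (cK n) (cQ n) (cE₂ n) (cJ4 n) (cΛ₂ n) (cR₂ n) (cQ₂ n) (x₀ n) (ωgl n) (ωgh n) N
      (WE n) (WJ n) (WΛ n) (WR n) (WQ n) hμν (hGa n hn) (fun b v => s n * gfrz n a b v) (hRest n hn)) (hU n hn)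

/-! ## §3 The RAY twin: ghost weights on the Ward ray, far rows in shell currency -/

/-- [folklore] **«ENDₛ» VARIANT** (rescaled tie `hωs` with a displayed family `s`; (REST′) words `restKS (gfrz n a b) (s n • gfrz n a b)`; `s ≡ 1` = the record) of the record's theorem of the same name without the `S`: **ROAD BF-x, END TO END, RE-CUT TABLE, GHOST WEIGHTS ON THE WARD RAY `(x₀, cK, cQ) := (−cgh n, cgh n·n², cgh n·a)`, FAR ROWS IN SHELL
CURRENCY**: `d1Drift_BFx_recut_shell` with `hrowgh` DISCHARGED by `GhostKernelComplete.hasSum_row_fineHessGhQ_ray` — the twin of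
`RoadEndBFxRecutRay.d1Drift_BFx_recut_ray` (p224967) with h2∕d2 ↦ h2s∕d2s. -/
theorem d1Drift_BFx_recut_ray_shellS (Js : ℕ → JetData 3 Lc) (hμν : μ ≠ ν) (hN : N ≠ 0) (hL : 2 ≤ Lc) (hodd : Odd Lc) (ha : 0 < a)
    (c : ℕ → ℝ) (hD₂ : 0 ≤ D₂) (hA : ∀ j, 0 ≤ A j) (hδ : 0 < δ)
    (h2s : ∀ n : ℕ, 2 ≤ n → ∀ [NeZero n], ∀ b ∈ (univ : Finset (Fin 4 → Fin n)).image resSite, ∀ r : ℕ, r + 1 ≤ n →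
      ∑ v ∈ annulus 4 r (r + 1), |(gfrz n a b (v + unitVec ν + unitVec μ) - gFree (v + unitVec ν + unitVec μ)) -
          (gfrz n a b (v + unitVec ν) - gFree (v + unitVec ν)) - (gfrz n a b (v + unitVec μ) - gFree (v + unitVec μ)) +
          (gfrz n a b v - gFree v)| ≤ D₂ / (n : ℝ))
    (d0 : ∀ n : ℕ, 2 ≤ n → ∀ [NeZero n], ∀ b ∈ (univ : Finset (Fin 4 → Fin n)).image resSite, ∀ v : Pt, v ≠ 0 →
      |gfrz n a b v| ≤ A 0 * Real.exp (-(δ / n) * supNorm v) / (supNorm v : ℝ) ^ 2)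
    (d1 : ∀ n : ℕ, 2 ≤ n → ∀ [NeZero n], ∀ b ∈ (univ : Finset (Fin 4 → Fin n)).image resSite, ∀ v : Pt, v ≠ 0 → ∀ ρ : Fin 4,
      |gfrz n a b (v + unitVec ρ) - gfrz n a b v| ≤ A 1 * Real.exp (-(δ / n) * supNorm v) / (supNorm v : ℝ) ^ 3)
    (d2s : ∀ n : ℕ, 2 ≤ n → ∀ [NeZero n], ∀ b ∈ (univ : Finset (Fin 4 → Fin n)).image resSite, ∀ r : ℕ, n ≤ r →
      ∑ v ∈ annulus 4 r (r + 1), |gfrz n a b (v + unitVec ν + unitVec μ) - gfrz n a b (v + unitVec ν) - gfrz n a b (v + unitVec μ) + gfrz n a b v| ≤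
        A 2 * Real.exp (-(δ / n) * ((r : ℝ) + 1)) / ((r : ℝ) + 1))
    (hB1 : ∀ m : ℕ, 1 ≤ m → |(∑ j ∈ range m, B12Beta.secondMoment (TbalOf Lc Js j) μ ν) - c (Lc ^ m)| ≤ U₁)
    (hGa : ∀ n : ℕ, 2 ≤ n → ∀ [NeZero n], Spr (Ga n a))
    (hK : ∀ n : ℕ, 2 ≤ n → Odd n → ∀ [NeZero n], c n =
      ωgl n * B12Beta.secondMoment (TOfRed n a (SbfBal n a (cE n) (cVH n) (cΛ n) (cR n) (cgh n * (n : ℝ) ^ 2) (cgh n * a))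
        (tableRed n (Wbf (cE₂ n) (cJ4 n) (cΛ₂ n) (cR₂ n) (cQ₂ n) (WE n) (WJ n) (WΛ n) (WR n) (WQ n)))) μ ν
      + ωgh n * B12Beta.secondMoment (PghQ n a (-cgh n) (cgh n * (n : ℝ) ^ 2) (cgh n * a)) μ ν + ∑ u, Ru u n)
    (s : ℕ → ℝ) (hωs : ∀ n : ℕ, 2 ≤ n → ωgh n * (s n * (cgh n * (n : ℝ) ^ 2)) ^ 2 = -2 * (ωgl n * cE n ^ 2))
    (hlam : ∀ n : ℕ, 2 ≤ n → ωgl n * cE n ^ 2 = 2 * N ^ 2 * (n : ℝ) ^ 8)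
    (hδW : ∀ n, 0 < δW n)
    (hE : ∀ n κ u l u', BiLoc (WE n κ u l u') u u' (CE n) (δW n)) (hJ : ∀ n κ u l u', BiLoc (WJ n κ u l u') u u' (CJ n) (δW n))
    (hΛ : ∀ n κ u l u', BiLoc (WΛ n κ u l u') u u' (CΛ n) (δW n)) (hR : ∀ n κ u l u', BiLoc (WR n κ u l u') u u' (CRt n) (δW n))
    (hQ : ∀ n κ u l u', BiLoc (WQ n κ u l u') u u' (CQ n) (δW n))
    (hEc : ∀ (n : ℕ) (κ : Fin 4) (u : Site 4) (l : Fin 4) (u' t : Site 4),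
      WE n κ (u + (n : ℤ) • t) l (u' + (n : ℤ) • t) = shiftK (-((n : ℤ) • t)) (WE n κ u l u'))
    (hJc : ∀ (n : ℕ) (κ : Fin 4) (u : Site 4) (l : Fin 4) (u' t : Site 4),
      WJ n κ (u + (n : ℤ) • t) l (u' + (n : ℤ) • t) = shiftK (-((n : ℤ) • t)) (WJ n κ u l u'))
    (hΛc : ∀ (n : ℕ) (κ : Fin 4) (u : Site 4) (l : Fin 4) (u' t : Site 4),
      WΛ n κ (u + (n : ℤ) • t) l (u' + (n : ℤ) • t) = shiftK (-((n : ℤ) • t)) (WΛ n κ u l u'))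
    (hRc : ∀ (n : ℕ) (κ : Fin 4) (u : Site 4) (l : Fin 4) (u' t : Site 4),
      WR n κ (u + (n : ℤ) • t) l (u' + (n : ℤ) • t) = shiftK (-((n : ℤ) • t)) (WR n κ u l u'))
    (hQc : ∀ (n : ℕ) (κ : Fin 4) (u : Site 4) (l : Fin 4) (u' t : Site 4),
      WQ n κ (u + (n : ℤ) • t) l (u' + (n : ℤ) • t) = shiftK (-((n : ℤ) • t)) (WQ n κ u l u'))
    (hEs : ∀ n κ u l u', WE n κ u l u' = WE n l u' κ u) (hJs : ∀ n κ u l u', WJ n κ u l u' = WJ n l u' κ u)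
    (hΛs : ∀ n κ u l u', WΛ n κ u l u' = WΛ n l u' κ u) (hRs : ∀ n κ u l u', WR n κ u l u' = WR n l u' κ u)
    (hQs : ∀ n κ u l u', WQ n κ u l u' = WQ n l u' κ u)
    (hdiv : ∀ n : ℕ, 2 ≤ n → ∀ [NeZero n], ∀ (l' : Fin 4) (u' u : Site 4), ∑ κ' : Fin 4,
      (fineHess n a (SbfBal n a (cE n) (cVH n) (cΛ n) (cR n) (cgh n * (n : ℝ) ^ 2) (cgh n * a))
          (Wbf (cE₂ n) (cJ4 n) (cΛ₂ n) (cR₂ n) (cQ₂ n) (WE n) (WJ n) (WΛ n) (WR n) (WQ n)) κ' l' (u - Pi.single κ' 1) u'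
        - fineHess n a (SbfBal n a (cE n) (cVH n) (cΛ n) (cR n) (cgh n * (n : ℝ) ^ 2) (cgh n * a))
          (Wbf (cE₂ n) (cJ4 n) (cΛ₂ n) (cR₂ n) (cQ₂ n) (WE n) (WJ n) (WΛ n) (WR n) (WQ n)) κ' l' u u') = 0)
    (hRest : ∀ n : ℕ, 2 ≤ n → ∀ [NeZero n], ∀ τ : RestIdx, τ ≠ cornerIdx →
      |∑ b ∈ (univ : Finset (Fin 4 → Fin n)).image resSite, ((n : ℝ) ^ 4)⁻¹ *
        fullSum (fun w : Pt => restKS n a (gfrz n a b) (fun v => s n * gfrz n a b v) (cE n) (cΛ n) (cR n) (cgh n * (n : ℝ) ^ 2) (cgh n * a) (cE₂ n) (cJ4 n) (cΛ₂ n) (cR₂ n)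
          (cQ₂ n) (-cgh n) (WE n) (WJ n) (WΛ n) (WR n) (WQ n) (ωgl n) (ωgh n) ((n : ℝ) ^ 8) N μ ν b τ w)| ≤ CR τ)
    (hU : ∀ n : ℕ, 2 ≤ n → ∀ u, |Ru u n| ≤ CU u) :
    D1Drift Lc Js N μ ν :=
  d1Drift_BFx_recut_shellS (x₀ := fun n => -cgh n) (cK := fun n => cgh n * (n : ℝ) ^ 2) (cQ := fun n => cgh n * a) Js hμν hN hL hodd ha c hD₂ hA
    hδ h2s d0 d1 d2s hB1 hGa hK s hωs hlam hδW hE hJ hΛ hR hQ hEc hJc hΛc hRc hQc hEs hJs hΛs hRs hQs hdiv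
    (fun n _ _ κ' l' b => hasSum_row_fineHessGhQ_ray n a ha (cgh n) κ' l' b) hRest hU

end Summit.QuantumFields.BalabanUV.Beta.D1BFx.RoadEndBFxRecutShellS

end
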